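import Summits.BirchSwinnertonDyer.Rank1Residual.X11b.QuadraticTorsionOfRam
import Summits.BirchSwinnertonDyer.Rank1Residual.X11b.CastellaErratum
import Literature.NumberTheory.EllipticCurves.IwasawaTowerTorsionProofs
import HarnessLib

/-!
# X11b, route R1 — `E(K_∞)[p^∞] = 0` over EVERY `ℤ_p`-extension of a quadratic field on the route's
# population: the (glob) hypothesis of the erratum's Lemma 2.1 on the real tower

HONEST FRAMING (cell `b2b-bsdres`, run/shared/lean/b2b/bsd-rank1-residual/, verbatim in every
file): the goal of the cell is to DELETE the COMBINATION-SHAPED residual classes of the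
Birch–Swinnerton-Dyer formula for ALL analytic-rank `≤ 1` elliptic curves over `ℚ` — "full BSD
formula for every rank `≤ 1` curve in class `C`" assembled STRICTLY from published theorems — so
that the rank-`≤ 1` remainder becomes exactly the CONSTRUCTION-SHAPED classes, which are TYPED
(missing-input `Prop`s), NOT attempted. This is not "finishing BSD". Sub-cell
`b2b-bsdres-multr1-p1` (X11b, route R1); a RESEARCH ROUTE; no claim beyond the stated class; X11b
stays CONSTRUCTION-SHAPED; nothing here changes a label. THEOREMS ONLY (no definition, no named
fact, no `sorry`).

## Content

Erratum (F. Castella, n.d.) p. 2 and Lemma 2.1: the congruence argument compares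
`Sel_𝔭^Σ(K_∞, A_f[ϖ^m])` with `Sel_𝔭^Σ(K_∞, A_f)[ϖ^m]`, which needs the vanishing of
`H⁰(K_∞, A_f[ϖ])` (glob) and of `H⁰(K_{∞,w}, A_f[ϖ])`, `w ∣ 𝔭` (loc) — "the new hypothesis (2) will
be forced on us to show that the Selmer groups `Sel_𝔭^Σ(K_∞, A_f)` behave well under congruences".
Gens 4–5 kernel-checked Lemma 2.1 as algebra with these as SOCLE hypotheses on abstract modules
(`InvariantsSocleCriterion`, `SelmerTorsionControl`); gen 6 proved `E(K)[p] = 0` for every quadratic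
`K` from `Irr ∧ Ram` (`torsion_eq_zero_of_irr_of_ram`). With the tree's pro-`p` descent
`WeierstrassCurve.fixedPoints_kerSubgroup_geomPrimaryTorsion_eq_bot` (Greenberg LNM 1716 §1 p. 62 /
proof of Prop. 4.8: a pro-`p` group acting on a non-zero `p`-group has a non-zero fixed point, so
`E(K)[p] = 0 ⇒ E(K_∞)[p^∞] = 0` for EVERY `ℤ_p`-extension) the GLOBAL hypothesis holds on the real
tower:

* **`fixedPoints_kerSubgroup_eq_bot_of_irr_of_ram`** — `W/ℚ` globally minimal, `p ≠ 2`, `E[p]`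
  irreducible and ramified at a multiplicative prime, `K` any quadratic number field, `κ` ANY
  `ℤ_p`-extension of `K` (in particular the anticyclotomic one): `E[p^∞]^{Gal(K̄/K_∞)} = 0`, i.e.
  `E(K_∞)[p^∞] = 0` — so `H⁰(K_∞, E[p]) = 0`, the (glob) hypothesis of Lemma 2.1 for `f = f_E`,
  `ϖ = p`, on the CONSTRUCTED tower of `AnticyclotomicSelmer.lean`.
* `ChainLocus.fixedPoints_kerSubgroup_eq_bot` (any quadratic `K`) and
  `ChainLocus.fixedPoints_kerSubgroup_eq_bot_of_isErratumField` — the same from route R1's class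
  predicate alone (`5 ≤ p`, `Irr`, the A′ (ram) witness).

(The LOCAL hypothesis at `w ∣ 𝔭` is erratum (iv) `E(ℚ_p)[p] = 0` pushed up the local tower
`K_{∞,w}/ℚ_p` by the same principle; gen 6–7 proved (iv) on `99.2 %` of ChainLocus and located its
residue inside `p ∣ ∏c` — `LocalTorsionMultiplicative`, `LocalTorsionTamagawa`; the local ascent is
not formalised here.) Labels unchanged; nothing booked.

References: [Castella2018Erratum] p. 2 (Remark) and Lemma 2.1; [GreenbergLNM1716] §1 p. 62, §4
p. 109.
-/

noncomputable section

open scoped Classical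

open WeierstrassCurve NumberField Literature.NumberTheory.EllipticCurves
  Literature.NumberTheory.EllipticCurves.Rank1Residual

namespace Summit.BirchSwinnertonDyer.Rank1Residual.X11b

variable (W : WeierstrassCurve ℚ) [W.IsElliptic] [W.IsGloballyMinimal] (p : ℕ) [Fact p.Prime]

/-- **`E(K_∞)[p^∞] = 0` over every `ℤ_p`-extension of a quadratic field, from `Irr ∧ Ram`.** For
`p ≠ 2`, `E[p]` irreducible (`Irr W p`) and ramified at some multiplicative prime (`Ram W p`), `K` a
quadratic number field and `κ` ANY `ℤ_p`-extension of `K`: the subgroup of `E[p^∞] = E(K̄)[p^∞]`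
fixed by `Gal(K̄/K_∞) = ker κ` is trivial. Proof: `E(K)[p] = 0` (gen 6, `torsion_eq_zero_of_irr_of_ram`:
a `K`-rational `p`-torsion point would be a `Γ_K`-fixed vector of the absolutely irreducible
`E[p]|Γ_K`) and the tree's pro-`p` descent `fixedPoints_kerSubgroup_geomPrimaryTorsion_eq_bot`. This is
the (glob) hypothesis `H⁰(K_∞, E[p]) = 0` of the erratum's Lemma 2.1 on the real anticyclotomic
tower. [cite: Castella2018Erratum, Lemma 2.1 and Remark p. 2] [cite: GreenbergLNM1716, §1 p. 62 and §4 p. 109] -/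
theorem fixedPoints_kerSubgroup_eq_bot_of_irr_of_ram (hp2 : p ≠ 2) (hirr : Irr W p) (hram : Ram W p)
    (K : Type) [Field K] [NumberField K] (hK : Module.finrank ℚ K = 2) (κ : ZpExtension K p) :
    FixedPoints.addSubgroup κ.kerSubgroup (geomPrimaryTorsion (W.baseChange K) p) = ⊥ := by
  haveI : (W.baseChange K).IsElliptic := by rw [baseChange]; infer_instance
  refine (W.baseChange K).fixedPoints_kerSubgroup_geomPrimaryTorsion_eq_bot κ fun P hP ↦ ?_
  exact Transvection.torsion_eq_zero_of_irr_of_ram W p hp2 hirr hram K hK P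
    (by rw [natCast_zsmul]; exact hP)

/-- **On route R1's population (`ChainLocus`)**, for every quadratic `K` and every `ℤ_p`-extension:
`E(K_∞)[p^∞] = 0`. [cite: Castella2018Erratum, Lemma 2.1 and Thm. A′ (p. 1)] -/
theorem ChainLocus.fixedPoints_kerSubgroup_eq_bot {W : WeierstrassCurve ℚ} [W.IsElliptic]
    [W.IsGloballyMinimal] {p : ℕ} [Fact p.Prime] (h : ChainLocus W p)
    (K : Type) [Field K] [NumberField K] (hK : Module.finrank ℚ K = 2) (κ : ZpExtension K p) :
    FixedPoints.addSubgroup κ.kerSubgroup (geomPrimaryTorsion (W.baseChange K) p) = ⊥ := by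
  haveI : (W.baseChange K).IsElliptic := by rw [baseChange]; infer_instance
  refine (W.baseChange K).fixedPoints_kerSubgroup_geomPrimaryTorsion_eq_bot κ fun P hP ↦ ?_
  exact h.torsion_eq_zero_quadratic K hK P (by rw [natCast_zsmul]; exact hP)

/-- **On an erratum field** (imaginary quadratic), for the pairs of `ChainLocus`: `E(K_∞)[p^∞] = 0`
for every `ℤ_p`-extension `κ` of `K` — the (glob) hypothesis of Lemma 2.1 at the data of route R1.
[cite: Castella2018Erratum, Lemma 2.1 and Thm. 1.1 (i)] -/
theorem ChainLocus.fixedPoints_kerSubgroup_eq_bot_of_isErratumField {W : WeierstrassCurve ℚ}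
    [W.IsElliptic] [W.IsGloballyMinimal] {p : ℕ} [Fact p.Prime] (h : ChainLocus W p) {q : ℕ}
    (K : Type) [Field K] [NumberField K] (hKf : IsErratumField W K q) (κ : ZpExtension K p) :
    FixedPoints.addSubgroup κ.kerSubgroup (geomPrimaryTorsion (W.baseChange K) p) = ⊥ :=
  h.fixedPoints_kerSubgroup_eq_bot K hKf.1.1 κ

end Summit.BirchSwinnertonDyer.Rank1Residual.X11b

end
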